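/-
Copyright (c) 2026 the pub-hodgecm-mathlib formalisation cell (harness21).  Prover seat hodgecm-mathlib-K2E3-p03 (g10) on the S4 valve (dealer K2E2-plan (g8), S4-R42∕R44∕R47:
road (J̃♭) FILE (TJ5) = the twisted tube Jacobian LETTER; layer [C] (C3)): HAAR MEASURE ALONG A NORM FIBRATION — the sheet formula.
Crux H413 `stmt-HodgeConjecture-24833`, lane `--supports … --as helper` (count-neutral).  THEOREMS ONLY (no `def`, no `instance`, no notation, no named-fact hypothesis, no `sorry`).
-/
import Literature.MeasureTheory.Group.InvariantQuotientSliceMass      -- ★ (Q1) frame: `quotientMeasure`, `fiberLIntegral`, Weil's formula with constant one (`InvariantQuotientNormalized`)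
import Literature.Topology.Metrizable.LocallyCompactPolish            -- ★ `polishSpace_of_locallyCompactSpace_of_secondCountableTopology` (Lusin–Souslin needs a Polish source)
import Summits.HodgeConjecture.HodgeConjecture.Theorems.K2E5HaarKerLiftHomeomorph   -- ★ K2E5-p02: `kerLift_comp_mk`, `kerLift_surjective`, `image_kerLift_eq`, `continuous_kerLift`, `isOpenMap_kerLift` (reused BY NAME)
import Mathlib.Topology.Algebra.Group.OpenMapping                     -- `MonoidHom.isOpenMap_of_sigmaCompact` (open mapping theorem for σ-compact groups)
import Mathlib.Topology.Baire.LocallyCompactRegular                   -- `BaireSpace.of_t2Space_locallyCompactSpace`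
import Mathlib.MeasureTheory.Measure.Haar.Unique                      -- `isMulLeftInvariant_eq_smul` (uniqueness of Haar measure, second countable)
import Mathlib.MeasureTheory.Constructions.Polish.Basic               -- `MeasurableSet.image_of_continuousOn_injOn` (Lusin–Souslin)
import HarnessLib

/-!
# R90-TF · S4 (Ch. 13.1–2) · road (J̃♭) «TWISTED TUBE JACOBIAN», FILE (TJ5) layer [C], part 2: HAAR MEASURE ALONG A NORM FIBRATION (the sheet formula)

Dealt by the S4 dealer K2E2-plan (g8) (S4-R42 02:31Z, plan of record S4-R44 02:35Z, socket word S4-R47 02:40Z).  Sibling of ★ `R90S4TwistedTubeSweep` ((C1)–(C2): the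
`ε`-twisted action of the torus `T̃` on itself SWEEPS every norm fibre, `N(r b ε(r)⁻¹) = N b`, and `Ψ '' (π(X·W) ×ˢ B) = Ψ♭ '' (X ×ˢ sweep(W, B))`).  THIS FILE is the
MEASURE half (C3), in the abstract frame of a continuous SURJECTIVE homomorphism `φ : A →* P` of second countable locally compact groups (at the datum: `A = T̃ =
Cent_{G̃_v}(γ₀)`, `P = T = G_{v,γ₀}`, `φ = N = epsNorm` — surjective by ★ `R90S4CartanNormMap.exists_mem_centralizer_epsNorm_eq`, print [Rogawski1990, §3.11
Prop. 3.11.1 (a), §12.5 p. 186: `1 → Z̃T̃ᴺ → T̃ —N→ Z∖T → 1`]), with Haar measures `τ` on `A`, `ρ` on the kernel `K = ker φ = T̃ᴺ` and `tP` on `P`: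
* §1 TOPOLOGY: `φ` is OPEN (`isOpenMap_of_surjective`, the open mapping theorem), `ker φ` is closed, and the induced `φ̄ = kerLift φ : A ⧸ K → P` is a
  HOMEOMORPHIC group isomorphism (`isHomeomorph_kerLift`).
* §2 BOREL BOOK-KEEPING (Lusin–Souslin): a Borel SHEET `Y ⊆ A` (a set on which `φ` is injective — at the datum the norm-section sheets `s(V)·u`, ★
  `R90S4TwistedTubeTransversal.injective_sheet`) has Borel image `φ '' Y`, Borel class set `π '' Y = φ̄⁻¹(φ '' Y)`, and the SWEPT SHEET `Y · T₀` (`T₀ ⊆ K` Borel) is Borel.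
* §3 THE FIBRE INTEGRAL OF A SWEPT SHEET: `∫_K 1_{Y T₀}(a k) f(φ(a k)) dρ(k) = ρ(T₀) · f(φ̄ ā) · 1_{π(Y)}(ā)` (`fiberLIntegral_indicator_sheet`): over a class meeting `Y` in
  `y` the `K`-slice of `Y T₀` is exactly `T₀` (injectivity of `φ` on `Y`), elsewhere it is empty.
* §4 TRANSPORT: `φ̄_* (τ∕ρ) = κ · tP` for a constant `0 < κ < ∞` (`exists_map_kerLift_quotientMeasure_eq_smul`: the push-forward of the ★ quotient measure is a left
  invariant Radon measure on `P`, hence a multiple of `tP` by uniqueness; `κ ≠ 0` by Weil's formula).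
* §5 **THE SHEET FORMULA** (`exists_sheet_lintegral_eq`): ONE constant `κ ∈ (0, ∞)` with, for EVERY Borel sheet `Y`, every Borel `T₀ ⊆ K` and every Borel `f ≥ 0` on `P`,
  **`∫⁻_{a ∈ Y·T₀} f(φ a) dτ = κ · ρ(T₀) · ∫⁻_{φ(Y)} f dtP`**, in particular `τ(Y·T₀) = κ · ρ(T₀) · tP(φ(Y))` — Weil's formula for `K ≤ A` (★ constant one) on the integrand
  of §3, then §4.  This is the Haar factorisation «`dδ` on the sheets `Z̃T̃ᴺ∖T̃` against `dt` on `T`» of the twisted Weyl integration formula [Rogawski1990, §12.5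
  p. 186], and exactly what (TJ5) consumes twice (once on the swept sheet `c(W)·s(V)u` with `f = cartanWeight`, once on the window), so that `κ` CANCELS.
HONEST LABEL: HC_CM is proved only modulo the 7 printed citations (2 remaining named inputs: hLiu418 = `stmt-HodgeConjecture-24832`, h413 = `stmt-HodgeConjecture-24833`)
until rung 0 closes; (J̃♭) OPEN; abstract measure theory, pays no socket by itself.

## References
* [Rogawski1990] J. Rogawski, *Automorphic Representations of Unitary Groups in Three Variables*, Ann. of Math. Stud. 123 (1990), §3.11 Prop. 3.11.1 pp. 34–35, §12.5 p. 186.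
* [DeitmarEchterhoff2014] A. Deitmar, S. Echterhoff, *Principles of Harmonic Analysis*, 2nd ed. (2014), Thm. 1.5.3 (quotient integral formula), Thm. 1.5.5 (open mapping).
* [Federer1969] H. Federer, *Geometric Measure Theory* (1969), §2.2.10 (Lusin–Souslin: injective Borel images).
-/

set_option autoImplicit false
-- the mandated namespace repeats the single-problem summit's segment (`HodgeConjecture.HodgeConjecture`)
set_option linter.dupNamespace false

noncomputable section

open MeasureTheory MeasureTheory.Measure Set Filter Topology Function
open scoped ENNReal NNReal Pointwise
open Literature.MeasureTheory.Group
open Summit.HodgeConjecture.HodgeConjecture.Cruxes.H413.K2E5HaarKerLiftHomeomorph (kerLift_comp_mk kerLift_surjective image_kerLift_eq continuous_kerLift isOpenMap_kerLift)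

namespace Summit.HodgeConjecture.HodgeConjecture.R90.S4

section NormFibration

variable {A P : Type*} [Group A] [Group P] (φ : A →* P)

/-! ## §1 The induced map `φ̄ = kerLift φ : A ⧸ ker φ → P` (★ K2E5-p02 for `φ̄ ∘ π = φ`, continuity, openness): class sets, equivariance; `φ` open, `ker φ` closed, `φ̄` a homeomorphism -/

/-- The class set of ANY `Y ⊆ A` is the `φ̄`-preimage of its image: `π '' Y = φ̄⁻¹' (φ '' Y)` (`φ̄` injective). [folklore] -/
theorem image_mk_eq_preimage_kerLift (Y : Set A) :
    (QuotientGroup.mk : A → A ⧸ φ.ker) '' Y = (QuotientGroup.kerLift φ) ⁻¹' (φ '' Y) := by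
  ext x
  obtain ⟨a, rfl⟩ := QuotientGroup.mk_surjective x
  simp only [mem_image, mem_preimage, QuotientGroup.kerLift_mk]
  constructor
  · rintro ⟨y, hy, hya⟩
    exact ⟨y, hy, by rw [← QuotientGroup.kerLift_mk φ y, hya, QuotientGroup.kerLift_mk]⟩
  · rintro ⟨y, hy, hφ⟩
    exact ⟨y, hy, QuotientGroup.kerLift_injective φ (by rw [QuotientGroup.kerLift_mk, QuotientGroup.kerLift_mk, hφ])⟩

/-- Equivariance `φ̄ (a • x) = φ a · φ̄ x`. [folklore] -/
theorem kerLift_smul (a : A) (x : A ⧸ φ.ker) : QuotientGroup.kerLift φ (a • x) = φ a * QuotientGroup.kerLift φ x := by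
  obtain ⟨b, rfl⟩ := QuotientGroup.mk_surjective x
  rw [MulAction.Quotient.smul_coe, smul_eq_mul, QuotientGroup.kerLift_mk, QuotientGroup.kerLift_mk, map_mul]

/-- The left action of `a ∈ A` on `A ⧸ ker φ` is left multiplication by `π a`. [folklore] -/
theorem smul_eq_mk_mul (a : A) : (fun x : A ⧸ φ.ker => a • x) = fun x => (QuotientGroup.mk a : A ⧸ φ.ker) * x :=
  funext fun x => by
    obtain ⟨b, rfl⟩ := QuotientGroup.mk_surjective x
    rw [MulAction.Quotient.smul_coe, smul_eq_mul, QuotientGroup.mk_mul]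

variable [TopologicalSpace A] [TopologicalSpace P]

/-- The kernel of a continuous homomorphism into a T₁ group is closed (`ker φ = φ⁻¹{1}`). [folklore] -/
theorem isClosed_ker [T1Space P] (hφc : Continuous φ) : IsClosed ((φ.ker : Subgroup A) : Set A) := by
  have h : ((φ.ker : Subgroup A) : Set A) = φ ⁻¹' {1} := by
    ext a
    simp only [SetLike.mem_coe, MonoidHom.mem_ker, mem_preimage, mem_singleton_iff]
  rw [h]
  exact isClosed_singleton.preimage hφc

variable [IsTopologicalGroup A]

/-- **Open mapping theorem**: a continuous surjective homomorphism from a σ-compact group onto a locally compact Hausdorff group is open.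
[cite: DeitmarEchterhoff2014, Thm. 1.5.5] -/
theorem isOpenMap_of_surjective [SigmaCompactSpace A] [IsTopologicalGroup P] [LocallyCompactSpace P] [T2Space P] (hφc : Continuous φ)
    (hφs : Function.Surjective φ) : IsOpenMap φ :=
  MonoidHom.isOpenMap_of_sigmaCompact φ hφs hφc

/-- **`φ̄ : A ⧸ ker φ → P` is a homeomorphism** (continuous, open, bijective) for a continuous surjective homomorphism of a σ-compact group onto a locally compact Hausdorff
group — the topological first isomorphism theorem. [cite: DeitmarEchterhoff2014, Thm. 1.5.5] -/
theorem isHomeomorph_kerLift [SigmaCompactSpace A] [IsTopologicalGroup P] [LocallyCompactSpace P] [T2Space P] (hφc : Continuous φ) (hφs : Function.Surjective φ) :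
    IsHomeomorph (QuotientGroup.kerLift φ) :=
  ⟨continuous_kerLift φ hφc, isOpenMap_kerLift φ (isOpenMap_of_surjective φ hφc hφs), ⟨QuotientGroup.kerLift_injective φ, kerLift_surjective φ hφs⟩⟩

/-! ## §2 The fibre integral of a swept sheet (pure measure algebra on `A`) -/

variable [MeasurableSpace A] [BorelSpace A]

omit [TopologicalSpace P] in
/-- **The `K`-fibre integral of a swept sheet**: for a sheet `Y` (`φ` injective on `Y`), `T₀ ⊆ K = ker φ` and `f` on `P`,
`∫_K 1_{Y·T₀}(a k) · f(φ(a k)) dρ(k) = 1_{π(Y)}(ā) · ρ(T₀) · f(φ̄ ā)`: over the class of `y ∈ Y` the slice `{k | y k ∈ Y T₀}` is exactly `T₀` and `f ∘ φ` is constant `= f(φ y)`;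
a class not meeting `Y` does not meet `Y·T₀`. [cite: DeitmarEchterhoff2014, Thm. 1.5.3] [cite: Rogawski1990, §12.5 p. 186] -/
theorem fiberLIntegral_indicator_sheet (ρ : Measure φ.ker) [ρ.IsMulLeftInvariant] {Y : Set A} (hinj : InjOn φ Y) {T₀ : Set φ.ker} (hT₀ : MeasurableSet T₀)
    (f : P → ℝ≥0∞) (x : A ⧸ φ.ker) :
    fiberLIntegral φ.ker ρ ((Y * (Subtype.val '' T₀ : Set A)).indicator fun a => f (φ a)) x =
      ((QuotientGroup.mk : A → A ⧸ φ.ker) '' Y).indicator (fun x => ρ T₀ * f (QuotientGroup.kerLift φ x)) x := by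
  classical
  by_cases hx : x ∈ (QuotientGroup.mk : A → A ⧸ φ.ker) '' Y
  · obtain ⟨y, hy, rfl⟩ := hx
    rw [indicator_of_mem (mem_image_of_mem _ hy), fiberLIntegral_mk, QuotientGroup.kerLift_mk]
    have hslice : ∀ k : φ.ker, (Y * (Subtype.val '' T₀ : Set A)).indicator (fun a => f (φ a)) (y * (k : A)) = T₀.indicator (fun _ => f (φ y)) k := by
      intro k
      by_cases hk : k ∈ T₀
      · have hmem : y * (k : A) ∈ Y * (Subtype.val '' T₀ : Set A) := Set.mul_mem_mul hy (mem_image_of_mem Subtype.val hk)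
        rw [indicator_of_mem hk, indicator_of_mem hmem, map_mul, (MonoidHom.mem_ker).1 k.2, mul_one]
      · rw [indicator_of_notMem hk, indicator_of_notMem]
        intro hmem
        obtain ⟨y', hy', t, ⟨t₀, ht₀, rfl⟩, hEq⟩ := Set.mem_mul.1 hmem
        have hφ : φ y' = φ y := by
          have h := congrArg φ hEq
          simpa only [map_mul, (MonoidHom.mem_ker).1 t₀.2, (MonoidHom.mem_ker).1 k.2, mul_one] using h
        have hyy : y' = y := hinj hy' hy hφ
        rw [hyy] at hEq
        have ht : t₀ = k := Subtype.ext (mul_left_cancel hEq)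
        exact hk (ht ▸ ht₀)
    simp_rw [hslice]
    rw [lintegral_indicator hT₀, setLIntegral_const, mul_comm]
  · rw [indicator_of_notMem hx]
    obtain ⟨a, rfl⟩ := QuotientGroup.mk_surjective x
    rw [fiberLIntegral_mk]
    have h0 : ∀ k : φ.ker, (Y * (Subtype.val '' T₀ : Set A)).indicator (fun a => f (φ a)) (a * (k : A)) = 0 := by
      intro k
      apply indicator_of_notMem
      intro hmem
      obtain ⟨y', hy', t, ⟨t₀, -, rfl⟩, hEq⟩ := Set.mem_mul.1 hmem
      refine hx ⟨y', hy', ?_⟩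
      rw [QuotientGroup.eq]
      have h : y'⁻¹ * a = (t₀ : A) * (k : A)⁻¹ := by
        rw [inv_mul_eq_iff_eq_mul, ← mul_assoc, hEq, mul_inv_cancel_right]
      rw [h]
      exact mul_mem t₀.2 (inv_mem k.2)
    simp_rw [h0, lintegral_zero]

/-! ## §3 Borel book-keeping for sheets (Lusin–Souslin) -/

variable [LocallyCompactSpace A] [SecondCountableTopology A] [T2Space A] [T2Space P]

omit [IsTopologicalGroup A] in
/-- **A Borel sheet has Borel image**: if `φ` is injective on the Borel set `Y ⊆ A` then `φ '' Y` is Borel (Lusin–Souslin; `A` is Polish).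
[cite: Federer1969, §2.2.10] -/
theorem measurableSet_image_of_injOn [MeasurableSpace P] [BorelSpace P] (hφc : Continuous φ) {Y : Set A} (hY : MeasurableSet Y) (hinj : InjOn φ Y) :
    MeasurableSet (φ '' Y) := by
  haveI : PolishSpace A := Literature.Topology.Metrizable.polishSpace_of_locallyCompactSpace_of_secondCountableTopology A
  exact hY.image_of_continuousOn_injOn hφc.continuousOn hinj

omit [IsTopologicalGroup A] in
/-- The class set `π '' Y` of a Borel sheet is Borel. [cite: Federer1969, §2.2.10] -/
theorem measurableSet_image_mk_of_injOn [MeasurableSpace P] [BorelSpace P] [MeasurableSpace (A ⧸ φ.ker)] [BorelSpace (A ⧸ φ.ker)] (hφc : Continuous φ) {Y : Set A}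
    (hY : MeasurableSet Y) (hinj : InjOn φ Y) : MeasurableSet ((QuotientGroup.mk : A → A ⧸ φ.ker) '' Y) := by
  rw [image_mk_eq_preimage_kerLift]
  exact (continuous_kerLift φ hφc).measurable (measurableSet_image_of_injOn φ hφc hY hinj)

/-- **The swept sheet `Y · T₀` is Borel** for a Borel sheet `Y` and a Borel `T₀ ⊆ ker φ`: it is the image of `Y ×ˢ T₀` under multiplication, which is injective there
(`y t = y′ t′ ⇒ φ y = φ y′ ⇒ y = y′ ⇒ t = t′`). [cite: Federer1969, §2.2.10] -/
theorem measurableSet_sheet_mul (hφc : Continuous φ) {Y : Set A} (hY : MeasurableSet Y) (hinj : InjOn φ Y) {T₀ : Set φ.ker} (hT₀ : MeasurableSet T₀) :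
    MeasurableSet (Y * (Subtype.val '' T₀ : Set A)) := by
  haveI : PolishSpace A := Literature.Topology.Metrizable.polishSpace_of_locallyCompactSpace_of_secondCountableTopology A
  have hKm : MeasurableSet ((φ.ker : Subgroup A) : Set A) := (isClosed_ker φ hφc).measurableSet
  have h1 : MeasurableSet (Subtype.val '' T₀ : Set A) := hKm.subtype_image hT₀
  rw [← Set.image_mul_prod]
  refine (hY.prod h1).image_of_continuousOn_injOn continuous_mul.continuousOn ?_
  rintro ⟨y, t⟩ ⟨hy, ⟨t₀, -, rfl⟩⟩ ⟨y', t'⟩ ⟨hy', ⟨t₀', -, rfl⟩⟩ hEq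
  have hEq' : y * (t₀ : A) = y' * (t₀' : A) := hEq
  have hφ : φ y = φ y' := by
    have h := congrArg φ hEq'
    simpa only [map_mul, (MonoidHom.mem_ker).1 t₀.2, (MonoidHom.mem_ker).1 t₀'.2, mul_one] using h
  have hyy : y = y' := hinj hy hy' hφ
  subst hyy
  rw [mul_left_cancel hEq']

/-! ## §4 Weil's formula on a swept sheet; transport of the quotient measure to `P` -/

variable [MeasurableSpace P] [BorelSpace P] [IsTopologicalGroup P] [SecondCountableTopology P] [LocallyCompactSpace P]

omit [IsTopologicalGroup P] [SecondCountableTopology P] [LocallyCompactSpace P] in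
/-- **Weil's formula on a swept sheet** (class-space form): with the ★ quotient measure `τ∕ρ` on `A ⧸ K`,
`∫⁻_A 1_{Y·T₀} · (f ∘ φ) dτ = ρ(T₀) · ∫⁻_{π(Y)} f ∘ φ̄ d(τ∕ρ)` — ★ `lintegral_fiberLIntegral_quotientMeasure` (constant one) on the integrand of `fiberLIntegral_indicator_sheet`.
[cite: DeitmarEchterhoff2014, Thm. 1.5.3] [cite: Rogawski1990, §12.5 p. 186] -/
theorem lintegral_indicator_sheet_eq_mul_setLIntegral_quotient (hφc : Continuous φ) [hK : IsClosed ((φ.ker : Subgroup A) : Set A)]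
    (ρ : Measure φ.ker) [ρ.IsMulLeftInvariant] [IsFiniteMeasureOnCompacts ρ] [ρ.IsOpenPosMeasure] [ρ.IsInvInvariant] [SFinite ρ]
    (τ : Measure A) [IsHaarMeasure τ] [τ.IsMulRightInvariant] [MeasurableSpace (A ⧸ φ.ker)] [BorelSpace (A ⧸ φ.ker)]
    {Y : Set A} (hY : MeasurableSet Y) (hinj : InjOn φ Y) {T₀ : Set φ.ker} (hT₀ : MeasurableSet T₀) {f : P → ℝ≥0∞} (hf : Measurable f) :
    ∫⁻ a, (Y * (Subtype.val '' T₀ : Set A)).indicator (fun a => f (φ a)) a ∂τ =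
      ρ T₀ * ∫⁻ x in (QuotientGroup.mk : A → A ⧸ φ.ker) '' Y, f (QuotientGroup.kerLift φ x) ∂quotientMeasure φ.ker ρ hK τ := by
  have hg : Measurable ((Y * (Subtype.val '' T₀ : Set A)).indicator fun a => f (φ a)) :=
    (hf.comp hφc.measurable).indicator (measurableSet_sheet_mul φ hφc hY hinj hT₀)
  rw [← lintegral_fiberLIntegral_quotientMeasure φ.ker ρ τ hg]
  have hfun : fiberLIntegral φ.ker ρ ((Y * (Subtype.val '' T₀ : Set A)).indicator fun a => f (φ a)) =
      ((QuotientGroup.mk : A → A ⧸ φ.ker) '' Y).indicator fun x => ρ T₀ * f (QuotientGroup.kerLift φ x) :=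
    funext (fiberLIntegral_indicator_sheet φ ρ hinj hT₀ f)
  have hfm : Measurable fun x : A ⧸ φ.ker => f (QuotientGroup.kerLift φ x) := hf.comp (continuous_kerLift φ hφc).measurable
  rw [hfun, lintegral_indicator (measurableSet_image_mk_of_injOn φ hφc hY hinj), lintegral_const_mul _ hfm]

/-- **Transport of the quotient measure**: for a continuous surjective `φ : A →* P` and Haar measures `τ`, `ρ`, `tP`, the push-forward of `τ∕ρ` along the
homeomorphic isomorphism `φ̄ : A ⧸ K ≃ P` is **`κ · tP` for ONE constant `κ ≠ 0`** (it is left invariant by `A`-invariance of `τ∕ρ` and equivariance of `φ̄`, Radon since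
`φ̄` is a homeomorphism, hence a multiple of `tP` by uniqueness of Haar measure; `κ = 0` would make `τ∕ρ`, hence `τ`, vanish by Weil's formula).
[cite: DeitmarEchterhoff2014, Thm. 1.5.3, Thm. 1.5.5] -/
theorem exists_map_kerLift_quotientMeasure_eq_smul (hφc : Continuous φ) (hφs : Function.Surjective φ) [hK : IsClosed ((φ.ker : Subgroup A) : Set A)]
    (ρ : Measure φ.ker) [ρ.IsMulLeftInvariant] [IsFiniteMeasureOnCompacts ρ] [ρ.IsOpenPosMeasure] [ρ.IsInvInvariant] [SFinite ρ]
    (τ : Measure A) [IsHaarMeasure τ] [τ.IsMulRightInvariant] (tP : Measure P) [IsHaarMeasure tP] [MeasurableSpace (A ⧸ φ.ker)] [BorelSpace (A ⧸ φ.ker)] :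
    ∃ κ : ℝ≥0, κ ≠ 0 ∧ (quotientMeasure φ.ker ρ hK τ).map (QuotientGroup.kerLift φ) = κ • tP := by
  set μ := quotientMeasure φ.ker ρ hK τ with hμ
  have hhom := isHomeomorph_kerLift φ hφc hφs
  have hmeas : Measurable (QuotientGroup.kerLift φ) := hhom.continuous.measurable
  set m := μ.map (QuotientGroup.kerLift φ) with hm
  haveI : m.IsMulLeftInvariant := by
    refine ⟨fun p => ?_⟩
    obtain ⟨a, rfl⟩ := hφs p
    have hcomm : (fun q : P => φ a * q) ∘ (QuotientGroup.kerLift φ) = (QuotientGroup.kerLift φ) ∘ fun x : A ⧸ φ.ker => a • x :=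
      funext fun x => (kerLift_smul φ a x).symm
    have hma : Measurable fun x : A ⧸ φ.ker => a • x := by
      rw [smul_eq_mk_mul φ a]
      exact (continuous_const_mul _).measurable
    rw [hm, Measure.map_map (measurable_const_mul (φ a)) hmeas, hcomm, ← Measure.map_map hmeas hma, map_smul_quotientMeasure φ.ker ρ hK τ a]
  haveI : IsFiniteMeasureOnCompacts m := ⟨fun C hC => by
    rw [hm, Measure.map_apply hmeas hC.measurableSet]
    exact ((Homeomorph.isCompact_preimage (IsHomeomorph.homeomorph (QuotientGroup.kerLift φ) hhom)).2 hC).measure_lt_top⟩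
  refine ⟨m.haarScalarFactor tP, fun h0 => ?_, isMulLeftInvariant_eq_smul m tP⟩
  -- `κ = 0` forces `m = 0`, `μ = 0`, and then `τ = 0` by Weil's formula
  have hm0 : m = 0 := by rw [isMulLeftInvariant_eq_smul m tP, h0, zero_smul]
  have hμ0 : μ Set.univ = 0 := by
    have h := congrArg (fun ν : Measure P => ν Set.univ) hm0
    simpa only [hm, Measure.map_apply hmeas MeasurableSet.univ, preimage_univ, Measure.coe_zero, Pi.zero_apply] using h
  have hμz : μ = 0 := Measure.measure_univ_eq_zero.1 hμ0
  have hW := lintegral_fiberLIntegral_quotientMeasure φ.ker ρ τ (f := fun _ => (1 : ℝ≥0∞)) measurable_const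
  rw [← hμ, hμz, lintegral_zero_measure, lintegral_const, one_mul] at hW
  exact (isOpen_univ.measure_ne_zero τ univ_nonempty) hW.symm

/-! ## §5 The sheet formula -/

/-- **THE SHEET FORMULA (Haar measure along a norm fibration).**  For a continuous surjective homomorphism `φ : A →* P` of second countable locally compact groups
with Haar measures `τ` (on `A`, two-sided), `ρ` (on `K = ker φ`, inversion invariant) and `tP` (on `P`) there is ONE constant `κ ∈ (0, ∞)` such that for EVERY Borel
sheet `Y ⊆ A` (`φ` injective on `Y`), every Borel `T₀ ⊆ K` and every Borel `f ≥ 0` on `P`: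
**`∫⁻_A 1_{Y·T₀}(a) f(φ a) dτ(a) = κ · ρ(T₀) · ∫⁻_{φ(Y)} f dtP`** — Weil's formula for `K ≤ A` on the swept sheet (§2, §4) followed by the transport `φ̄_*(τ∕ρ) = κ · tP`.
At the datum (`φ = N : T̃ → T`, `Y = s(V)·u` a norm-section sheet, `T₀ = (1−ε)W` the sweep of a window, `f = cartanWeight`) this is the passage from `dδ` on the sheets to
`dt` on `T` in the twisted Weyl integration formula. [cite: Rogawski1990, §12.5 p. 186] [cite: DeitmarEchterhoff2014, Thm. 1.5.3] -/
theorem exists_sheet_lintegral_eq (hφc : Continuous φ) (hφs : Function.Surjective φ) [hK : IsClosed ((φ.ker : Subgroup A) : Set A)]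
    (ρ : Measure φ.ker) [ρ.IsMulLeftInvariant] [IsFiniteMeasureOnCompacts ρ] [ρ.IsOpenPosMeasure] [ρ.IsInvInvariant] [SFinite ρ]
    (τ : Measure A) [IsHaarMeasure τ] [τ.IsMulRightInvariant] (tP : Measure P) [IsHaarMeasure tP] [MeasurableSpace (A ⧸ φ.ker)] [BorelSpace (A ⧸ φ.ker)] :
    ∃ κ : ℝ≥0∞, κ ≠ 0 ∧ κ ≠ ⊤ ∧ ∀ Y : Set A, MeasurableSet Y → InjOn φ Y → ∀ T₀ : Set φ.ker, MeasurableSet T₀ → ∀ f : P → ℝ≥0∞, Measurable f →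
      ∫⁻ a, (Y * (Subtype.val '' T₀ : Set A)).indicator (fun a => f (φ a)) a ∂τ = κ * ρ T₀ * ∫⁻ p in φ '' Y, f p ∂tP := by
  obtain ⟨κ, hκ, hmap⟩ := exists_map_kerLift_quotientMeasure_eq_smul φ hφc hφs ρ τ tP
  have hmap' : (quotientMeasure φ.ker ρ hK τ).map (QuotientGroup.kerLift φ) = (κ : ℝ≥0∞) • tP := by rw [hmap]; rfl
  refine ⟨κ, by exact_mod_cast hκ, ENNReal.coe_ne_top, fun Y hY hinj T₀ hT₀ f hf => ?_⟩
  have hmeas : Measurable (QuotientGroup.kerLift φ) := (continuous_kerLift φ hφc).measurable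
  have hφY : MeasurableSet (φ '' Y) := measurableSet_image_of_injOn φ hφc hY hinj
  rw [lintegral_indicator_sheet_eq_mul_setLIntegral_quotient φ hφc ρ τ hY hinj hT₀ hf, ← lintegral_indicator (measurableSet_image_mk_of_injOn φ hφc hY hinj)]
  have hind : ((QuotientGroup.mk : A → A ⧸ φ.ker) '' Y).indicator (fun x => f (QuotientGroup.kerLift φ x)) = fun x => (φ '' Y).indicator f (QuotientGroup.kerLift φ x) := by
    funext x
    rw [image_mk_eq_preimage_kerLift]
    exact indicator_comp_right (QuotientGroup.kerLift φ)
  rw [hind, ← lintegral_map (hf.indicator hφY) hmeas, hmap', lintegral_smul_measure, lintegral_indicator hφY, smul_eq_mul]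
  ring

/-- **Mass form of the sheet formula**: with the constant `κ` of `exists_sheet_lintegral_eq`, `τ(Y·T₀) = κ · ρ(T₀) · tP(φ(Y))` and
`∫⁻_{Y·T₀} f ∘ φ dτ = κ · ρ(T₀) · ∫⁻_{φ(Y)} f dtP` for every Borel sheet `Y`, Borel `T₀ ⊆ K`, Borel `f ≥ 0`. [cite: Rogawski1990, §12.5 p. 186] [cite: DeitmarEchterhoff2014, Thm. 1.5.3] -/
theorem exists_sheet_measure_eq (hφc : Continuous φ) (hφs : Function.Surjective φ) [hK : IsClosed ((φ.ker : Subgroup A) : Set A)]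
    (ρ : Measure φ.ker) [ρ.IsMulLeftInvariant] [IsFiniteMeasureOnCompacts ρ] [ρ.IsOpenPosMeasure] [ρ.IsInvInvariant] [SFinite ρ]
    (τ : Measure A) [IsHaarMeasure τ] [τ.IsMulRightInvariant] (tP : Measure P) [IsHaarMeasure tP] [MeasurableSpace (A ⧸ φ.ker)] [BorelSpace (A ⧸ φ.ker)] :
    ∃ κ : ℝ≥0∞, κ ≠ 0 ∧ κ ≠ ⊤ ∧ ∀ Y : Set A, MeasurableSet Y → InjOn φ Y → ∀ T₀ : Set φ.ker, MeasurableSet T₀ →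
      τ (Y * (Subtype.val '' T₀ : Set A)) = κ * ρ T₀ * tP (φ '' Y) ∧
        ∀ f : P → ℝ≥0∞, Measurable f → ∫⁻ a in Y * (Subtype.val '' T₀ : Set A), f (φ a) ∂τ = κ * ρ T₀ * ∫⁻ p in φ '' Y, f p ∂tP := by
  obtain ⟨κ, hκ0, hκt, h⟩ := exists_sheet_lintegral_eq φ hφc hφs ρ τ tP
  refine ⟨κ, hκ0, hκt, fun Y hY hinj T₀ hT₀ => ⟨?_, fun f hf => ?_⟩⟩
  · have h1 := h Y hY hinj T₀ hT₀ (fun _ => 1) measurable_const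
    rwa [lintegral_indicator (measurableSet_sheet_mul φ hφc hY hinj hT₀), setLIntegral_one, setLIntegral_one] at h1
  · rw [← lintegral_indicator (measurableSet_sheet_mul φ hφc hY hinj hT₀)]
    exact h Y hY hinj T₀ hT₀ f hf

/-! ## §6 (ED. 2) `κ`-explicit forms and the mass of an open subgroup window

For the (TJ5) assembly the SAME constant `κ` must serve the swept sheet AND the window `W_j = T̃ ∩ c(Λ_j)`: the forms below take the transport identity
`φ̄_*(τ∕ρ) = κ • tP` of §4 as a HYPOTHESIS (`hmap`), so that any two consequences share `κ`, and `exists_sheet_and_subgroup_eq` bundles them under one `∃ κ`. -/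

omit [IsTopologicalGroup P] [SecondCountableTopology P] [LocallyCompactSpace P] in
/-- **Sheet formula, `κ`-explicit**: if `(τ∕ρ).map φ̄ = κ • tP` then `∫⁻_A 1_{Y·T₀} (f ∘ φ) dτ = κ · ρ(T₀) · ∫⁻_{φ(Y)} f dtP` for every Borel sheet `Y`, Borel
`T₀ ⊆ K`, Borel `f ≥ 0`. [cite: Rogawski1990, §12.5 p. 186] [cite: DeitmarEchterhoff2014, Thm. 1.5.3] -/
theorem sheet_lintegral_eq_of_map_eq (hφc : Continuous φ) [hK : IsClosed ((φ.ker : Subgroup A) : Set A)]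
    (ρ : Measure φ.ker) [ρ.IsMulLeftInvariant] [IsFiniteMeasureOnCompacts ρ] [ρ.IsOpenPosMeasure] [ρ.IsInvInvariant] [SFinite ρ]
    (τ : Measure A) [IsHaarMeasure τ] [τ.IsMulRightInvariant] (tP : Measure P) [MeasurableSpace (A ⧸ φ.ker)] [BorelSpace (A ⧸ φ.ker)]
    {κ : ℝ≥0∞} (hmap : (quotientMeasure φ.ker ρ hK τ).map (QuotientGroup.kerLift φ) = κ • tP)
    {Y : Set A} (hY : MeasurableSet Y) (hinj : InjOn φ Y) {T₀ : Set φ.ker} (hT₀ : MeasurableSet T₀) {f : P → ℝ≥0∞} (hf : Measurable f) :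
    ∫⁻ a, (Y * (Subtype.val '' T₀ : Set A)).indicator (fun a => f (φ a)) a ∂τ = κ * ρ T₀ * ∫⁻ p in φ '' Y, f p ∂tP := by
  have hmeas : Measurable (QuotientGroup.kerLift φ) := (continuous_kerLift φ hφc).measurable
  have hφY : MeasurableSet (φ '' Y) := measurableSet_image_of_injOn φ hφc hY hinj
  rw [lintegral_indicator_sheet_eq_mul_setLIntegral_quotient φ hφc ρ τ hY hinj hT₀ hf, ← lintegral_indicator (measurableSet_image_mk_of_injOn φ hφc hY hinj)]
  have hind : ((QuotientGroup.mk : A → A ⧸ φ.ker) '' Y).indicator (fun x => f (QuotientGroup.kerLift φ x)) = fun x => (φ '' Y).indicator f (QuotientGroup.kerLift φ x) := by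
    funext x
    rw [image_mk_eq_preimage_kerLift]
    exact indicator_comp_right (QuotientGroup.kerLift φ)
  rw [hind, ← lintegral_map (hf.indicator hφY) hmeas, hmap, lintegral_smul_measure, lintegral_indicator hφY, smul_eq_mul]
  ring

omit [SecondCountableTopology P] in
/-- **Mass of an OPEN SUBGROUP window, `κ`-explicit**: if `(τ∕ρ).map φ̄ = κ • tP` then for every open subgroup `W ≤ A`,
**`τ(W) = κ · ρ(K ∩ W) · tP(φ(W))`** — ★ (Q1) `measure_eq_quotientMeasure_image_mk_mul_of_slice` in `(A, K)` (the `K`-slice of `W` through any of its points is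
`K ∩ W`, `W` being a subgroup), then `π(W) = φ̄⁻¹(φ(W))` and the transport (`φ(W)` is open by the open mapping theorem, hence Borel).  At the datum: `W = T̃ ∩ c(Λ_j)`,
`τ̃(W_j) = κ · ρ(T̃ᴺ ∩ W_j) · t_T(N(W_j))`. [cite: DeitmarEchterhoff2014, Thm. 1.5.3] [cite: Rogawski1990, §12.5 p. 186] -/
theorem measure_subgroup_eq_of_map_eq (hφc : Continuous φ) (hφs : Function.Surjective φ) [hK : IsClosed ((φ.ker : Subgroup A) : Set A)]
    (ρ : Measure φ.ker) [ρ.IsMulLeftInvariant] [IsFiniteMeasureOnCompacts ρ] [ρ.IsOpenPosMeasure] [ρ.IsInvInvariant] [SFinite ρ]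
    (τ : Measure A) [IsHaarMeasure τ] [τ.IsMulRightInvariant] (tP : Measure P) [MeasurableSpace (A ⧸ φ.ker)] [BorelSpace (A ⧸ φ.ker)]
    {κ : ℝ≥0∞} (hmap : (quotientMeasure φ.ker ρ hK τ).map (QuotientGroup.kerLift φ) = κ • tP) (W : Subgroup A) (hW : IsOpen (W : Set A)) :
    τ W = κ * ρ (Subtype.val ⁻¹' (W : Set A)) * tP (φ '' W) := by
  have hmeas : Measurable (QuotientGroup.kerLift φ) := (continuous_kerLift φ hφc).measurable
  have hT₀ : MeasurableSet (Subtype.val ⁻¹' (W : Set A) : Set φ.ker) := (hW.preimage continuous_subtype_val).measurableSet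
  have hslice : ∀ w ∈ (W : Set A), {k : φ.ker | w * (k : A) ∈ (W : Set A)} = Subtype.val ⁻¹' (W : Set A) := by
    intro w hw
    ext k
    simp only [mem_setOf_eq, mem_preimage, SetLike.mem_coe]
    exact ⟨fun h => by simpa only [inv_mul_cancel_left] using W.mul_mem (W.inv_mem hw) h, fun h => W.mul_mem hw h⟩
  have hφW : MeasurableSet (φ '' (W : Set A)) := (isOpenMap_of_surjective φ hφc hφs _ hW).measurableSet
  rw [measure_eq_quotientMeasure_image_mk_mul_of_slice φ.ker ρ τ hW.measurableSet (measurableSet_image_mk_of_isOpen' φ.ker hW) hT₀ hslice,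
    image_mk_eq_preimage_kerLift, ← Measure.map_apply hmeas hφW, hmap, Measure.smul_apply, smul_eq_mul]
  ring

/-- **THE SHEET FORMULA AND THE WINDOW MASS UNDER ONE CONSTANT.**  For a continuous surjective `φ : A →* P` of second countable locally compact groups and Haar
measures `τ`, `ρ`, `tP` there is ONE `κ ∈ (0, ∞)` with BOTH (i) `∫⁻_A 1_{Y·T₀} (f ∘ φ) dτ = κ · ρ(T₀) · ∫⁻_{φ(Y)} f dtP` for all Borel sheets `Y`, Borel `T₀ ⊆ K`, Borel
`f ≥ 0`, AND (ii) `τ(W) = κ · ρ(K ∩ W) · tP(φ(W))` for all open subgroups `W ≤ A` — so that in the (TJ5) quotient of (i) by (ii) the constant cancels.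
[cite: Rogawski1990, §12.5 p. 186] [cite: DeitmarEchterhoff2014, Thm. 1.5.3] -/
theorem exists_sheet_and_subgroup_eq (hφc : Continuous φ) (hφs : Function.Surjective φ) [hK : IsClosed ((φ.ker : Subgroup A) : Set A)]
    (ρ : Measure φ.ker) [ρ.IsMulLeftInvariant] [IsFiniteMeasureOnCompacts ρ] [ρ.IsOpenPosMeasure] [ρ.IsInvInvariant] [SFinite ρ]
    (τ : Measure A) [IsHaarMeasure τ] [τ.IsMulRightInvariant] (tP : Measure P) [IsHaarMeasure tP] [MeasurableSpace (A ⧸ φ.ker)] [BorelSpace (A ⧸ φ.ker)] :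
    ∃ κ : ℝ≥0∞, κ ≠ 0 ∧ κ ≠ ⊤ ∧
      (∀ Y : Set A, MeasurableSet Y → InjOn φ Y → ∀ T₀ : Set φ.ker, MeasurableSet T₀ → ∀ f : P → ℝ≥0∞, Measurable f →
        ∫⁻ a, (Y * (Subtype.val '' T₀ : Set A)).indicator (fun a => f (φ a)) a ∂τ = κ * ρ T₀ * ∫⁻ p in φ '' Y, f p ∂tP) ∧
      (∀ W : Subgroup A, IsOpen (W : Set A) → τ W = κ * ρ (Subtype.val ⁻¹' (W : Set A)) * tP (φ '' W)) := by
  obtain ⟨κ, hκ, hmap⟩ := exists_map_kerLift_quotientMeasure_eq_smul φ hφc hφs ρ τ tP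
  have hmap' : (quotientMeasure φ.ker ρ hK τ).map (QuotientGroup.kerLift φ) = (κ : ℝ≥0∞) • tP := by rw [hmap]; rfl
  exact ⟨κ, by exact_mod_cast hκ, ENNReal.coe_ne_top, fun Y hY hinj T₀ hT₀ f hf => sheet_lintegral_eq_of_map_eq φ hφc ρ τ tP hmap' hY hinj hT₀ hf,
    fun W hW => measure_subgroup_eq_of_map_eq φ hφc hφs ρ τ tP hmap' W hW⟩

end NormFibration

end Summit.HodgeConjecture.HodgeConjecture.R90.S4

end
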